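import Summits.Parity.GeneralizedHardyLittlewood.Theorems.FordMaynardSieveConst01651SieveConst01651BuchstabTableWalk
import Literature.Analysis.Convolution.ConvolutionPowerIntegerArithmetic
import Literature.LinearAlgebra.Matrix.ModularDiagonalSolver
import HarnessLib

/-!
# Route `FordMaynardSieveConst01651`, target `SieveConst01651` (stmt-Parity-19185), stub `stub_certValuePos` (R2):
# SOUNDNESS of the Volterra table, II — chained generations and the enclosure of `Φ₆` at `ν₀`

Def-free helper file for the definitions of `…BuchstabTable` (`tabWalk`, `tabGen`, `tabNext`, `tabRun`,
`tabJ = 120000`, `tabK = 19812`, `tabD = 2⁴⁰`).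

* List bookkeeping: `tabWalk_acc` (accumulators are prepended), `tabGen_succ` (cons form of one step), `tabGen_length`.
* One cell, abstract `Φ, Ψ` with `Ψ ≥ 0` monotone, `Φ(x) = (1 + Ψ(x − ν))/x` on `(ν, 7ν)`, `ν = K/J`:
  `cell_lower` / `cell_upper` (`⌊(D+Ψ⁻_{i−K})J/(i+1)⌋/D ≤ Φ ≤ ⌈(D+Ψ⁺_{i+1−K})J/i⌉/D` on `(x_i, x_{i+1}]`),
  `psi_lower_step` / `psi_upper_step` (directed rounding of `Ψ(x_{i+1}) = Ψ(x_i) + ∫_{cell} Φ`).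
* `tabGen_sound` — the walk invariant (induction on the number of cells); `tabRun_sound` — the five chained
  generations (`1 ≤ g ≤ 5`, all cells below `7ν`), including the shifted upper lag list `tail ++ [last]`.
* Instantiation at `ν₀ = 0.1651` with `Φ₆ = Σ_{m ≤ 6} φ_{ν₀}^{⋆m}/m!`, `Ψ(y) = ∫_{(0,y]} Φ₆` (hypotheses from
  `…BuchstabKernel`: Volterra equation, positivity, support, monotonicity): `tabRun_sound_phiSix`,
  **`phiSix_cell_bounds`** (`Φ⁻_m/D ≤ Φ₆ ≤ Φ⁺_m/D` on every cell `(x_m, x_{m+1}]`, `K ≤ m < 6K`) and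
  **`phiSix_one_bounds`** (`(D + Ψ⁻)/D ≤ Φ₆(1) ≤ (D + Ψ⁺)/D` at the entry `1128` of generation `5`, i.e. `x = 1 − ν₀`).

The kernel evaluates the whole table in ≈ 50 s (`decide`), bit-identical to the Python mirror; with it
`Φ₆(1) ∈ [3.4006671, 3.4007822]` (true `3.4007246`).

References: [FordMaynard2024PrimeSieves] arXiv:2407.14368, Theorem 7.3 (a), §8.2; A. A. Buchstab (1937).
-/

noncomputable section

open MeasureTheory Set Finset
open scoped Classical
open Literature.NumberTheory.Sieve Literature.NumberTheory.Sieve.FordMaynard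
open Literature.Analysis.Convolution

namespace Summit.Parity.GeneralizedHardyLittlewood.FordMaynardSieveConst01651SieveConst01651
/-! ### Lengths -/

/-- The generation walk outputs lists of length `n`. [folklore] -/
theorem tabGen_length (J D : ℕ) : ∀ (n i : ℕ) (ll lh : List ℕ) (pl ph : ℕ),
    (tabGen J D i n ll lh pl ph).phiLo.length = n ∧ (tabGen J D i n ll lh pl ph).phiHi.length = n ∧
    (tabGen J D i n ll lh pl ph).psiLo.length = n ∧ (tabGen J D i n ll lh pl ph).psiHi.length = n
  | 0, i, ll, lh, pl, ph => by simp [tabGen, tabWalk]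
  | n + 1, i, ll, lh, pl, ph => by
    obtain ⟨e1, e2, e3, e4, -, -⟩ := tabGen_succ J D i n ll lh pl ph
    obtain ⟨l1, l2, l3, l4⟩ := tabGen_length J D n (i + 1) ll.tail lh.tail
      (pl + ((D + ll.headD 0) * J) / (i + 1) / J) (ph + (((D + lh.headD 0) * J + i - 1) / i + J - 1) / J)
    rw [e1, e2, e3, e4]
    simp only [List.length_cons, l1, l2, l3, l4, and_self]

/-- The shifted lag list `tail ++ [last]`: entries before the end. [folklore] -/
theorem getD_tail_append_of_lt (l : List ℕ) (a : ℕ) {j : ℕ} (hj : j + 1 < l.length) :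
    (l.tail ++ [a]).getD j 0 = l.getD (j + 1) 0 := by
  rw [List.getD_append _ _ _ _ (by simp; omega), Literature.LinearAlgebra.Matrix.ModDiag.getD_tail]

/-- The shifted lag list `tail ++ [last]`: the last entry. [folklore] -/
theorem getD_tail_append_last (l : List ℕ) (a : ℕ) {j : ℕ} (hj : j + 1 = l.length) :
    (l.tail ++ [a]).getD j 0 = a := by
  rw [List.getD_append_right _ _ _ _ (by simp; omega), show j - l.tail.length = 0 by simp; omega]
  rfl

/-! ### Soundness of the chained generations -/

/-- **Soundness of the table, generation by generation** (`1 ≤ g ≤ 5`, so that every cell lies below `7ν`):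
the lists of `tabRun J D K g` bound `Φ` on the cells `(x_{gK+j}, x_{gK+j+1}]` and `Ψ` at the points `x_{gK+j}`
(`j < K`), and the final values bound `Ψ(x_{(g+1)K})`. [folklore] -/
theorem tabRun_sound {Φ Ψ : ℝ → ℝ} {J K D : ℕ} (hJ : 0 < J) (hD : 0 < D) (hK : 1 ≤ K)
    (hΨm : Monotone Ψ) (hΨ0 : ∀ y, 0 ≤ Ψ y) (hΨν : ∀ y, y ≤ (K : ℝ) / J → Ψ y = 0)
    (hvolt : ∀ x, (K : ℝ) / J < x → x < 7 * ((K : ℝ) / J) → Φ x = (1 + Ψ (x - K / J)) / x)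
    (hint : ∀ a b : ℝ, IntegrableOn Φ (Set.Ioc a b))
    (hsplit : ∀ a b : ℝ, 0 ≤ a → a ≤ b → Ψ b = Ψ a + ∫ x in Set.Ioc a b, Φ x) :
    ∀ g : ℕ, 1 ≤ g → g ≤ 5 →
      (∀ j < K, ∀ x ∈ Set.Ioc (((g * K + j : ℕ) : ℝ) / J) ((((g * K + j : ℕ) : ℝ) + 1) / J),
          (((tabRun J D K g).phiLo.getD j 0 : ℕ) : ℝ) / D ≤ Φ x ∧
            Φ x ≤ (((tabRun J D K g).phiHi.getD j 0 : ℕ) : ℝ) / D) ∧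
      (∀ j < K, (((tabRun J D K g).psiLo.getD j 0 : ℕ) : ℝ) / D ≤ Ψ (((g * K + j : ℕ) : ℝ) / J) ∧
          Ψ (((g * K + j : ℕ) : ℝ) / J) ≤ (((tabRun J D K g).psiHi.getD j 0 : ℕ) : ℝ) / D) ∧
      ((((tabRun J D K g).pl : ℕ) : ℝ) / D ≤ Ψ ((((g + 1) * K : ℕ) : ℝ) / J) ∧
        Ψ ((((g + 1) * K : ℕ) : ℝ) / J) ≤ (((tabRun J D K g).ph : ℕ) : ℝ) / D) ∧
      (tabRun J D K g).psiLo.length = K ∧ (tabRun J D K g).psiHi.length = K := by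
  have hD0 : (0 : ℝ) < D := by exact_mod_cast hD
  intro g hg1 hg5
  induction g with
  | zero => omega
  | succ g ih =>
    rcases Nat.eq_zero_or_pos g with rfl | hgpos
    · -- generation 1
      have hgen := tabGen_sound hJ hD hK hΨm hΨ0 hvolt hint hsplit K K (List.replicate K 0) (List.replicate K 0) 0 0
        le_rfl (by omega)
        (by simp only [Nat.cast_zero, zero_div]; exact hΨ0 _)
        (by rw [hΨν _ le_rfl]; simp)
        (fun j hj => by
          rw [List.getD_eq_getElem?_getD, List.getElem?_replicate_of_lt hj]
          simp only [Option.getD_some, Nat.cast_zero, zero_div]; exact hΨ0 _)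
        (fun j hj => by
          rw [List.getD_eq_getElem?_getD, List.getElem?_replicate_of_lt hj, hΨν]
          · simp
          · rw [show K + j + 1 - K = j + 1 by omega]
            exact div_le_div_of_nonneg_right (by exact_mod_cast hj) (by exact_mod_cast hJ.le))
      obtain ⟨a1, a2, a3⟩ := hgen
      obtain ⟨-, -, l3, l4⟩ := tabGen_length J D K K (List.replicate K 0) (List.replicate K 0) 0 0
      simp only [zero_add, one_mul, tabRun]
      refine ⟨fun j hj x hx => a1 j hj x hx, fun j hj => a2 j hj, ?_, l3, l4⟩
      rw [show 2 * K = K + K by ring]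
      exact a3
    · -- generation g + 1 ≥ 2 from generation g
      have hg : 1 ≤ g := hgpos
      obtain ⟨p1, p2, p3, pl3, pl4⟩ := ih hg (by omega)
      obtain ⟨g', rfl⟩ : ∃ g', g = g' + 1 := ⟨g - 1, by omega⟩
      show _ ∧ _ ∧ _ ∧ (tabRun J D K (g' + 2)).psiLo.length = K ∧ (tabRun J D K (g' + 2)).psiHi.length = K
      have hrun : tabRun J D K (g' + 2) = tabNext J D K (g' + 2) (tabRun J D K (g' + 1)) := rfl
      rw [hrun]
      unfold tabNext
      set prev := tabRun J D K (g' + 1) with hprev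
      have hgen := tabGen_sound hJ hD hK hΨm hΨ0 hvolt hint hsplit K ((g' + 2) * K) prev.psiLo
        (prev.psiHi.tail ++ [prev.ph]) prev.pl prev.ph
        (by nlinarith) (by nlinarith)
        (by have := p3.1; rwa [show g' + 1 + 1 = g' + 2 by ring] at this)
        (by have := p3.2; rwa [show g' + 1 + 1 = g' + 2 by ring] at this)
        (fun j hj => by
          rw [show (g' + 2) * K + j - K = (g' + 1) * K + j by
            simp only [add_mul, one_mul]; omega]
          exact (p2 j hj).1)
        (fun j hj => by
          by_cases hj' : j + 1 < K
          · rw [getD_tail_append_of_lt _ _ (by omega),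
              show (g' + 2) * K + j + 1 - K = (g' + 1) * K + (j + 1) by simp only [add_mul, one_mul]; omega]
            exact (p2 (j + 1) hj').2
          · have hjK : j + 1 = K := by omega
            rw [getD_tail_append_last _ _ (by omega),
              show (g' + 2) * K + j + 1 - K = (g' + 1 + 1) * K by simp only [add_mul, one_mul]; omega]
            exact p3.2)
      obtain ⟨a1, a2, a3⟩ := hgen
      obtain ⟨-, -, l3, l4⟩ := tabGen_length J D K ((g' + 2) * K) prev.psiLo (prev.psiHi.tail ++ [prev.ph])
        prev.pl prev.ph
      refine ⟨a1, a2, ?_, l3, l4⟩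
      rw [show (g' + 2 + 1) * K = (g' + 2) * K + K by ring]
      exact a3

/-! ### Instantiation: the table encloses Buchstab's `Φ₆` at `ν₀ = 0.1651` -/

/-- **The route's table encloses `Φ₆` and `Ψ`.**  With `Φ₆ = Σ_{m ≤ 6} φ_{ν₀}^{⋆m}/m!`, `Ψ(y) = ∫_{(0,y]} Φ₆`,
`J = 120000`, `K = 19812`, `D = 2⁴⁰`: for `1 ≤ g ≤ 5` the generation `tabRun J D K g` bounds `Φ₆` on its cells and `Ψ`
at its grid points (all hypotheses of `tabRun_sound` discharged by `…BuchstabKernel`). [folklore] -/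
theorem tabRun_sound_phiSix (g : ℕ) (hg1 : 1 ≤ g) (hg5 : g ≤ 5) :
    (∀ j < tabK, ∀ x ∈ Set.Ioc (((g * tabK + j : ℕ) : ℝ) / tabJ) ((((g * tabK + j : ℕ) : ℝ) + 1) / tabJ),
        (((tabRun tabJ tabD tabK g).phiLo.getD j 0 : ℕ) : ℝ) / tabD ≤
            ∑ m ∈ Finset.Icc 1 6, (1 / (m.factorial : ℝ)) *
              cpow (fun t : ℝ => if (1651 / 10000 : ℝ) < t then 1 / t else 0) m x ∧
          ∑ m ∈ Finset.Icc 1 6, (1 / (m.factorial : ℝ)) *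
              cpow (fun t : ℝ => if (1651 / 10000 : ℝ) < t then 1 / t else 0) m x ≤
            (((tabRun tabJ tabD tabK g).phiHi.getD j 0 : ℕ) : ℝ) / tabD) ∧
    (∀ j < tabK,
        (((tabRun tabJ tabD tabK g).psiLo.getD j 0 : ℕ) : ℝ) / tabD ≤
            ∫ t in Set.Ioc 0 (((g * tabK + j : ℕ) : ℝ) / tabJ), ∑ m ∈ Finset.Icc 1 6, (1 / (m.factorial : ℝ)) *
              cpow (fun t : ℝ => if (1651 / 10000 : ℝ) < t then 1 / t else 0) m t ∧
          ∫ t in Set.Ioc 0 (((g * tabK + j : ℕ) : ℝ) / tabJ), ∑ m ∈ Finset.Icc 1 6, (1 / (m.factorial : ℝ)) *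
              cpow (fun t : ℝ => if (1651 / 10000 : ℝ) < t then 1 / t else 0) m t ≤
            (((tabRun tabJ tabD tabK g).psiHi.getD j 0 : ℕ) : ℝ) / tabD) ∧
    ((((tabRun tabJ tabD tabK g).pl : ℕ) : ℝ) / tabD ≤
          ∫ t in Set.Ioc 0 ((((g + 1) * tabK : ℕ) : ℝ) / tabJ), ∑ m ∈ Finset.Icc 1 6, (1 / (m.factorial : ℝ)) *
            cpow (fun t : ℝ => if (1651 / 10000 : ℝ) < t then 1 / t else 0) m t ∧
        ∫ t in Set.Ioc 0 ((((g + 1) * tabK : ℕ) : ℝ) / tabJ), ∑ m ∈ Finset.Icc 1 6, (1 / (m.factorial : ℝ)) *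
            cpow (fun t : ℝ => if (1651 / 10000 : ℝ) < t then 1 / t else 0) m t ≤
          (((tabRun tabJ tabD tabK g).ph : ℕ) : ℝ) / tabD) := by
  have hν : (0 : ℝ) < 1651 / 10000 := by norm_num
  have hKJ : ((tabK : ℕ) : ℝ) / (tabJ : ℕ) = 1651 / 10000 := by norm_num [tabK, tabJ]
  set Φ : ℝ → ℝ := fun x => ∑ m ∈ Finset.Icc 1 6, (1 / (m.factorial : ℝ)) *
    cpow (fun t : ℝ => if (1651 / 10000 : ℝ) < t then 1 / t else 0) m x with hΦ
  set Ψ : ℝ → ℝ := fun y => ∫ t in Set.Ioc 0 y, Φ t with hΨ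
  have hΦb : LocBdd Φ := locBdd_buchstabPhi hν 6
  have hΦ0 : ∀ x, 0 ≤ Φ x := fun x => buchstabPhi_nonneg hν.le 6 x
  have hΨm : Monotone Ψ := fun a b hab => buchstabPsi_mono hν hab
  have hΨ0 : ∀ y, 0 ≤ Ψ y := fun y => setIntegral_nonneg measurableSet_Ioc fun t _ => hΦ0 t
  have hΨν : ∀ y, y ≤ ((tabK : ℕ) : ℝ) / (tabJ : ℕ) → Ψ y = 0 := fun y hy =>
    buchstabPsi_eq_zero_of_le hν (by rw [hKJ] at hy; exact hy)
  have hvolt : ∀ x, ((tabK : ℕ) : ℝ) / (tabJ : ℕ) < x → x < 7 * (((tabK : ℕ) : ℝ) / (tabJ : ℕ)) →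
      Φ x = (1 + Ψ (x - (tabK : ℕ) / (tabJ : ℕ))) / x := by
    intro x h1 h2
    rw [hKJ] at h1 h2 ⊢
    have hx : 0 < x := hν.trans h1
    have hv := buchstab_volterra_six hν h2
    rw [if_pos h1] at hv
    rw [eq_div_iff hx.ne', mul_comm]
    exact hv
  have hint : ∀ a b : ℝ, IntegrableOn Φ (Set.Ioc a b) := fun a b => hΦb.integrableOn_Ioc a b
  have hsplit : ∀ a b : ℝ, 0 ≤ a → a ≤ b → Ψ b = Ψ a + ∫ x in Set.Ioc a b, Φ x := by
    intro a b ha hab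
    simp only [hΨ]
    rw [← Set.Ioc_union_Ioc_eq_Ioc ha hab, setIntegral_union ?_ measurableSet_Ioc (hint 0 a) (hint a b)]
    exact Set.disjoint_left.2 fun x hx hx' => (not_lt.2 hx.2) hx'.1
  have hJ : 0 < tabJ := by norm_num [tabJ]
  have hD : 0 < tabD := by norm_num [tabD]
  have hK : 1 ≤ tabK := by norm_num [tabK]
  obtain ⟨a, b, c, -, -⟩ := tabRun_sound hJ hD hK hΨm hΨ0 hΨν hvolt hint hsplit g hg1 hg5
  exact ⟨a, b, c⟩

/-- **Cell enclosure by absolute index.**  For `K ≤ m < 6K` and `x ∈ (x_m, x_{m+1}]`,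
`Φ⁻/D ≤ Φ₆(x) ≤ Φ⁺/D` with `Φ^∓` the entries `m % K` of generation `m / K`. [folklore] -/
theorem phiSix_cell_bounds {m : ℕ} (hm1 : tabK ≤ m) (hm2 : m < 6 * tabK) {x : ℝ}
    (hx : x ∈ Set.Ioc ((m : ℝ) / tabJ) (((m : ℝ) + 1) / tabJ)) :
    (((tabRun tabJ tabD tabK (m / tabK)).phiLo.getD (m % tabK) 0 : ℕ) : ℝ) / tabD ≤
        ∑ k ∈ Finset.Icc 1 6, (1 / (k.factorial : ℝ)) *
          cpow (fun t : ℝ => if (1651 / 10000 : ℝ) < t then 1 / t else 0) k x ∧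
      ∑ k ∈ Finset.Icc 1 6, (1 / (k.factorial : ℝ)) *
          cpow (fun t : ℝ => if (1651 / 10000 : ℝ) < t then 1 / t else 0) k x ≤
        (((tabRun tabJ tabD tabK (m / tabK)).phiHi.getD (m % tabK) 0 : ℕ) : ℝ) / tabD := by
  have hK0 : 0 < tabK := by norm_num [tabK]
  have hg1 : 1 ≤ m / tabK := (Nat.le_div_iff_mul_le hK0).2 (by simpa using hm1)
  have hg5 : m / tabK ≤ 5 := by
    have : m / tabK < 6 := Nat.div_lt_of_lt_mul (by rw [mul_comm]; exact hm2)
    omega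
  have hj : m % tabK < tabK := Nat.mod_lt _ hK0
  have hm : m / tabK * tabK + m % tabK = m := Nat.div_add_mod' m tabK
  have h := (tabRun_sound_phiSix (m / tabK) hg1 hg5).1 (m % tabK) hj x (by rw [hm]; exact hx)
  exact h

/-- **`Φ₆(1)` enclosed**: `(D + Ψ⁻)/D ≤ Φ₆(1) ≤ (D + Ψ⁺)/D` with `Ψ^∓` the entries `1128` of generation `5`
(`x_{5K+1128} = 1 − ν₀`, `Φ₆(1) = 1 + Ψ(1 − ν₀)`). [folklore] -/
theorem phiSix_one_bounds :
    (((tabD + (tabRun tabJ tabD tabK 5).psiLo.getD 1128 0 : ℕ) : ℝ)) / tabD ≤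
        ∑ m ∈ Finset.Icc 1 6, (1 / (m.factorial : ℝ)) *
          cpow (fun t : ℝ => if (1651 / 10000 : ℝ) < t then 1 / t else 0) m 1 ∧
      ∑ m ∈ Finset.Icc 1 6, (1 / (m.factorial : ℝ)) *
          cpow (fun t : ℝ => if (1651 / 10000 : ℝ) < t then 1 / t else 0) m 1 ≤
        (((tabD + (tabRun tabJ tabD tabK 5).psiHi.getD 1128 0 : ℕ) : ℝ)) / tabD := by
  have h := (tabRun_sound_phiSix 5 (by norm_num) le_rfl).2.1 1128 (by norm_num [tabK])
  have hpt : (((5 * tabK + 1128 : ℕ) : ℝ)) / (tabJ : ℕ) = 1 - 1651 / 10000 := by norm_num [tabK, tabJ]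
  rw [hpt] at h
  have hD : (0 : ℝ) < tabD := by norm_num [tabD]
  rw [phiSix_one_eq]
  constructor
  · rw [Nat.cast_add, add_div, div_self hD.ne']
    linarith [h.1]
  · rw [Nat.cast_add, add_div, div_self hD.ne']
    linarith [h.2]

end Summit.Parity.GeneralizedHardyLittlewood.FordMaynardSieveConst01651SieveConst01651

end
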